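import Summits.SmoothPoincare4.SmoothPoincare4.Theorems.SymplecticOrigamiGromovRecognitionRelEndHelperNormalWitnessTransfer
import Summits.SmoothPoincare4.SmoothPoincare4.Theses.SullivanDual

/-!
# `SullivanDual.NormalWitnessTransfer` (item stmt-SmoothPoincare4-18059) is PROVED

The support item `NormalWitnessTransfer` of route `SullivanDual` (C2 of the split piece `AdjunctionEmbeddedSpheres`,
stmt-SmoothPoincare4-16775, = the registered stub `stub_normalWitnessTransfer` of its birth skeleton): a
trivial-normal-bundle witness (`N`, submersion `π` cutting the sphere out) transfers from an embedded two-chart sphere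
to any embedded two-chart sphere with homotopic glued map. The route decl is, verbatim, the registered helper
`helper_normalWitnessTransfer` of line `cross-cap-laurent` of crux `GromovRecognitionRelEnd` (stmt-SmoothPoincare4-11009,
`…HelperNormalWitnessTransfer.lean`; Kirby 1989 Ch. VIII Thm. 2 in transport form + Lee 2013 Thm. 6.24).

References: R. Kirby, *The Topology of 4-Manifolds*, LNM 1374 (1989), Ch. VIII Thm. 2; J. Lee, *Introduction to
Smooth Manifolds* (2013), Thm. 6.24. No new definitions, notation or instances.
-/

open scoped Manifold ContDiff Topology

-- the prescribed namespace `Summit.<P>.<Sub>.…` duplicates `SmoothPoincare4` (P = Sub)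
set_option linter.dupNamespace false

namespace Summit.SmoothPoincare4.SmoothPoincare4.Theorems

/-- **`SullivanDual.NormalWitnessTransfer` holds** (transfer of a trivial-normal-bundle witness along a homotopy of
embedded two-chart spheres; Kirby 1989 Ch. VIII Thm. 2, Lee 2013 Thm. 6.24), by `helper_normalWitnessTransfer`. -/
theorem NormalWitnessTransfer_proof : Summit.SmoothPoincare4.SmoothPoincare4.Theses.SullivanDual.NormalWitnessTransfer := by
  unfold Summit.SmoothPoincare4.SmoothPoincare4.Theses.SullivanDual.NormalWitnessTransfer
  exact Summit.SmoothPoincare4.SmoothPoincare4.Theorems.GromovRecognitionRelEnd.CrossCapLaurent.helper_normalWitnessTransfer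

end Summit.SmoothPoincare4.SmoothPoincare4.Theorems
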